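import Summits.NavierStokesRegularity.NavierStokesRegularity.Theorems.PoloidalWindowDoorPoloidalWindowRigidityZShockPSystemNonuniformConst
import Summits.NavierStokesRegularity.NavierStokesRegularity.Theorems.PoloidalWindowDoorLrcModEntireTwistingTHPoincareLemma
import HarnessLib

/-!
# Crux K2 `PoloidalWindowRigidity` (stmt-NavierStokesRegularity-19708), line `z_shock` — RUNG R2 IN THE SCALAR (HEIGHT-EVOLUTION)
# CURRENCY: a two-sided bounded `C²` solution of the SCALAR genuinely nonlinear wave equation `w_zz = ∂ₓ(κ(w)² ∂ₓw)` on `ℝ × ℝ` is constant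

`--supports stmt-NavierStokesRegularity-19708 --as helper` (leafhand-ns-poloidalwindowdoor-3 g7, cell decomp-ns, 2026-08-31).  Class-free,
def-free, Mathlib + tree files only.  **No stub and no summit is closed by this file; Navier–Stokes regularity is NOT proved here (rung 0).**

WHY THIS FILE.  The deciding stub `stub_zShockThickAut` of `Cruxes/PoloidalWindowRigidity/Lines/z_shock.lean` produces, on an autonomous
window, the SCALAR second-order height-evolution `w_zz + Δₕ[G(w)] = 0` (tree `…ZShockHeightEvolution.heightEvolution_of_class_autonomy`,
`…ZShockSliceTyping.slice_wave_pde`: `∂ₛ∂ₛW = Σᵢ ∂ᵢ(γ(W) ∂ᵢW)`, `γ = −G > 0`).  The tree's rung R2 (the 1-D Liouville theorem, Lax 1964 /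
John 1974 read two-sidedly; sharp non-uniform form `…ZShockPSystemNonuniformConst.pSystem_const_nonuniform`, p823120) is stated for the
FIRST-ORDER p-system `p_z = −κ(w)² w_x`, `w_z = −p_x` — it needs the partner unknown `p`, which the height-evolution does not supply.  The
standing repair census of the crux (hands 3-g3 … 3-g6, exit report 2026-08-31T16:00Z) names the missing piece: «a Poincaré-lemma construction
of `p` from a scalar `C²` solution on `ℝ²`».  This file supplies it and states R2 in the scalar currency:

* `exists_potential_prod` — coordinate Poincaré lemma on `ℝ × ℝ`: a `C¹` pair `(A, B)` with `∂ₓA = ∂_zB` is `(∂_z p, ∂ₓ p)` for a `C²`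
  function `p` (transport of the tree's ray-potential lemma `…TwistingTHPoincareLemma.exists_potential_of_planar_curlFree` along the
  coordinate isomorphism `EuclideanSpace ℝ (Fin 2) ≃L ℝ × ℝ`);
* `exists_pSystem_partner` — a `C²` solution `w` of `∂_z∂_z w = ∂ₓ(κ(w)² ∂ₓw)` (`κ ∈ C¹`) has a `C²` partner `p` with
  `p_z = −κ(w)² w_x`, `w_z = −p_x`, i.e. `(w, p)` solves the autonomous p-system of the tree files (the closed 1-form is
  `−κ(w)² w_x dz − w_z dx`, closed exactly by the equation);
* `scalarWave_const_nonuniform` — ★ **R2, scalar form.**  A two-sided (`z ∈ ℝ` = first coordinate) `C²` solution of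
  `w_zz = ∂ₓ(κ(w)² w_x)` on `ℝ × ℝ` with `w`, `w_x`, `w_z` bounded, `0 < κlo ≤ κ(w) ≤ κhi`, `|κ'(w)| ≤ k₁` along the solution, for a `C¹`
  speed `κ > 0` (with a `C²` primitive `K`) whose derivative `κ' ≥ 0` is continuous and not identically zero on any interval, is CONSTANT.
  Hypotheses = those of `pSystem_const_nonuniform` with the three p-system clauses replaced by the one scalar equation; no hypothesis on `p`
  is left over (the partner's regularity and equations are produced, its size is never used);
* `scalarWave_const_nonuniform_antitone` — the same with `κ' ≤ 0` (reflection `w ↦ −w`, `κ ↦ κ(−·)`).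

So in one horizontal dimension the kinematic lever of the line is a theorem in exactly the currency the height-evolution speaks: every planar
(`y ↦ k·y`) bounded eternal profile of the autonomous thick column with one-signed `G''` is constant.  (Planar profiles are outside the stubs'
twist clause; this is the 1-D SHADOW R2 of the census, not R3.)  [folklore] (Lax 1964; John 1974; Klainerman–Majda 1980 — method of
characteristics / Riccati law for the Riemann-invariant gradients, here imported from the tree.)  presearch: R2 scalar↔p-system equivalence
is textbook (Courant–Friedrichs; Dafermos, *Hyperbolic Conservation Laws* §7.1 «the p-system … equivalent to the wave equation
`u_tt = σ(u_x)_x`»); nothing to cite beyond folklore.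
-/

noncomputable section

namespace Summit.NavierStokesRegularity.NavierStokesRegularity.Theorems.PoloidalWindowDoorPoloidalWindowRigidityZShockScalarWaveLiouville

-- the summit and its single sub-problem share the name (CONVENTIONS §1)
set_option linter.dupNamespace false

open Set Filter Topology Function
open Summit.NavierStokesRegularity.NavierStokesRegularity.Theorems.PoloidalWindowDoorPoloidalWindowRigidityZShockPSystemNonuniformConst
open Summit.NavierStokesRegularity.NavierStokesRegularity.Theorems.PoloidalWindowDoorLrcModEntireTwistingTHPoincareLemma

/-! ### The coordinate Poincaré lemma on `ℝ × ℝ` -/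

/-- **Poincaré lemma on `ℝ × ℝ`, coordinate form.**  If `A, B : ℝ × ℝ → ℝ` are `C¹` and `∂ₓA = ∂_zB` everywhere (`z` = first, `x` = second
coordinate), then there is a `C²` function `p` with `∂_z p = A` and `∂ₓ p = B`.  (The tree's ray potential of the planar field `(A, B)`,
transported along `EuclideanSpace ℝ (Fin 2) ≃L[ℝ] ℝ × ℝ`.) [folklore] -/
theorem exists_potential_prod {A B : ℝ × ℝ → ℝ} (hA : ContDiff ℝ 1 A) (hB : ContDiff ℝ 1 B)
    (hcomp : ∀ q : ℝ × ℝ, fderiv ℝ A q (0, 1) = fderiv ℝ B q (1, 0)) :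
    ∃ p : ℝ × ℝ → ℝ, ContDiff ℝ 2 p ∧ (∀ q, fderiv ℝ p q (1, 0) = A q) ∧ ∀ q, fderiv ℝ p q (0, 1) = B q := by
  -- the coordinate isomorphism and its matrix entries
  set e : EuclideanSpace ℝ (Fin 2) ≃L[ℝ] ℝ × ℝ :=
    (EuclideanSpace.equiv (Fin 2) ℝ).trans (ContinuousLinearEquiv.finTwoArrow ℝ ℝ) with he_def
  have he0 : ∀ u v : ℝ, e.symm (u, v) 0 = u := by intro u v; simp [he_def]
  have he1 : ∀ u v : ℝ, e.symm (u, v) 1 = v := by intro u v; simp [he_def]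
  have hes0 : e.symm (1, 0) = EuclideanSpace.single 0 1 := by
    ext i; fin_cases i <;> simp [he_def]
  have hes1 : e.symm (0, 1) = EuclideanSpace.single 1 1 := by
    ext i; fin_cases i <;> simp [he_def]
  have he_s0 : e (EuclideanSpace.single 0 1) = (1, 0) := by rw [← hes0, e.apply_symm_apply]
  have he_s1 : e (EuclideanSpace.single 1 1) = (0, 1) := by rw [← hes1, e.apply_symm_apply]
  -- the planar field `a = (A, B)` read on `EuclideanSpace ℝ (Fin 2)`
  set AB : ℝ × ℝ → ℝ × ℝ := fun q => (A q, B q) with hAB_def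
  have hAB : ContDiff ℝ 1 AB := hA.prodMk hB
  have hA1 : Differentiable ℝ A := hA.differentiable one_ne_zero
  have hB1 : Differentiable ℝ B := hB.differentiable one_ne_zero
  have hABd : ∀ q, HasFDerivAt AB ((fderiv ℝ A q).prod (fderiv ℝ B q)) q := fun q =>
    (hA1 q).hasFDerivAt.prodMk (hB1 q).hasFDerivAt
  set a : EuclideanSpace ℝ (Fin 2) → EuclideanSpace ℝ (Fin 2) := fun y => e.symm (AB (e y)) with ha_def
  have ha : ContDiff ℝ 1 a := e.symm.contDiff.comp (hAB.comp e.contDiff)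
  have had : ∀ y, HasFDerivAt a
      ((e.symm : ℝ × ℝ →L[ℝ] EuclideanSpace ℝ (Fin 2)).comp
        (((fderiv ℝ A (e y)).prod (fderiv ℝ B (e y))).comp (e : EuclideanSpace ℝ (Fin 2) →L[ℝ] ℝ × ℝ))) y := by
    intro y
    exact e.symm.hasFDerivAt.comp y ((hABd (e y)).comp y e.hasFDerivAt)
  have hcurl : ∀ y : EuclideanSpace ℝ (Fin 2),
      fderiv ℝ a y (EuclideanSpace.single 0 1) 1 = fderiv ℝ a y (EuclideanSpace.single 1 1) 0 := by
    intro y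
    rw [(had y).fderiv]
    simp only [ContinuousLinearMap.coe_comp, ContinuousLinearEquiv.coe_coe, Function.comp_apply,
      ContinuousLinearMap.prod_apply, he_s0, he_s1, he0, he1]
    exact (hcomp (e y)).symm
  obtain ⟨φ, hφ, -, hφi⟩ := exists_potential_of_planar_curlFree (n := 1) le_rfl ha hcurl
  -- transport the potential back to `ℝ × ℝ`
  refine ⟨fun q => φ (e.symm q), ?_, ?_, ?_⟩
  · exact hφ.comp e.symm.contDiff
  · intro q
    have hφd : Differentiable ℝ φ := hφ.differentiable (by norm_num)
    have hpd : HasFDerivAt (fun q : ℝ × ℝ => φ (e.symm q))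
        ((fderiv ℝ φ (e.symm q)).comp (e.symm : ℝ × ℝ →L[ℝ] EuclideanSpace ℝ (Fin 2))) q :=
      (hφd (e.symm q)).hasFDerivAt.comp q e.symm.hasFDerivAt
    rw [hpd.fderiv]
    simp only [ContinuousLinearMap.coe_comp, ContinuousLinearEquiv.coe_coe, Function.comp_apply, hes0, hφi]
    rw [ha_def]
    simp only [ContinuousLinearEquiv.apply_symm_apply, hAB_def, he0]
  · intro q
    have hφd : Differentiable ℝ φ := hφ.differentiable (by norm_num)
    have hpd : HasFDerivAt (fun q : ℝ × ℝ => φ (e.symm q))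
        ((fderiv ℝ φ (e.symm q)).comp (e.symm : ℝ × ℝ →L[ℝ] EuclideanSpace ℝ (Fin 2))) q :=
      (hφd (e.symm q)).hasFDerivAt.comp q e.symm.hasFDerivAt
    rw [hpd.fderiv]
    simp only [ContinuousLinearMap.coe_comp, ContinuousLinearEquiv.coe_coe, Function.comp_apply, hes1, hφi]
    rw [ha_def]
    simp only [ContinuousLinearEquiv.apply_symm_apply, hAB_def, he1]

/-! ### The p-system partner of a scalar solution -/

variable {w : ℝ × ℝ → ℝ} {κ κ' K : ℝ → ℝ} {κlo κhi k₁ W₁ W₂ Mw : ℝ}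

/-- A `C¹` speed in the tree's `HasDerivAt` vocabulary is `ContDiff ℝ 1`. [folklore] -/
theorem contDiff_one_of_hasDerivAt (hκd : ∀ v, HasDerivAt κ (κ' v) v) (hκ'c : Continuous κ') : ContDiff ℝ 1 κ := by
  have hderiv : deriv κ = κ' := funext fun v => (hκd v).deriv
  have h : ContDiff ℝ (0 + 1) κ := by
    rw [contDiff_succ_iff_deriv]
    refine ⟨fun v => (hκd v).differentiableAt, by simp, ?_⟩
    rw [hderiv]
    exact contDiff_zero.2 hκ'c
  simpa using h

/-- **The p-system partner.**  If `w : ℝ × ℝ → ℝ` is `C²`, `κ` is `C¹`, and `w` solves the scalar wave equation in divergence form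
`∂_z(∂_z w) = ∂ₓ(κ(w)² ∂ₓ w)` at every point, then there is a `C²` function `p` with `p_z = −κ(w)² w_x` and `w_z = −p_x`: the pair `(w, p)`
solves the autonomous p-system of `…ZShockPSystemNonuniform`.  (Poincaré lemma for the 1-form `−κ(w)²w_x dz − w_z dx`, which is closed
exactly by the equation.) [folklore] -/
theorem exists_pSystem_partner (hw : ContDiff ℝ 2 w) (hκ : ContDiff ℝ 1 κ)
    (hpde : ∀ q : ℝ × ℝ, fderiv ℝ (fun q' => fderiv ℝ w q' (1, 0)) q (1, 0) =
      fderiv ℝ (fun q' => κ (w q') ^ 2 * fderiv ℝ w q' (0, 1)) q (0, 1)) :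
    ∃ p : ℝ × ℝ → ℝ, ContDiff ℝ 2 p ∧
      (∀ q, fderiv ℝ p q (1, 0) = -(κ (w q) ^ 2 * fderiv ℝ w q (0, 1))) ∧
      ∀ q, fderiv ℝ w q (1, 0) = -fderiv ℝ p q (0, 1) := by
  have hDw : ContDiff ℝ 1 (fderiv ℝ w) := hw.fderiv_right (m := 1) le_rfl
  have hwx : ContDiff ℝ 1 fun q' => fderiv ℝ w q' (0, 1) := hDw.clm_apply contDiff_const
  have hwz : ContDiff ℝ 1 fun q' => fderiv ℝ w q' (1, 0) := hDw.clm_apply contDiff_const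
  have hκw : ContDiff ℝ 1 fun q' => κ (w q') := hκ.comp (hw.of_le one_le_two)
  have hA : ContDiff ℝ 1 fun q' => -(κ (w q') ^ 2 * fderiv ℝ w q' (0, 1)) := ((hκw.pow 2).mul hwx).neg
  have hB : ContDiff ℝ 1 fun q' => -fderiv ℝ w q' (1, 0) := hwz.neg
  have hcomp : ∀ q : ℝ × ℝ, fderiv ℝ (fun q' => -(κ (w q') ^ 2 * fderiv ℝ w q' (0, 1))) q (0, 1) =
      fderiv ℝ (fun q' => -fderiv ℝ w q' (1, 0)) q (1, 0) := by
    intro q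
    rw [fderiv_fun_neg, fderiv_fun_neg, neg_apply, neg_apply, hpde q]
  obtain ⟨p, hp, hpz, hpx⟩ := exists_potential_prod hA hB hcomp
  refine ⟨p, hp, hpz, fun q => ?_⟩
  rw [hpx q, neg_neg]

/-! ### R2 in the scalar currency -/

/-- ★ **R2, scalar form (non-uniform genuine nonlinearity).**  A two-sided `C²` solution `w : ℝ × ℝ → ℝ` of the scalar wave equation
`∂_z∂_z w = ∂ₓ(κ(w)² ∂ₓ w)` (height `z` = first coordinate, ALL `z ∈ ℝ`) with `w`, `w_x`, `w_z` bounded, `0 < κlo ≤ κ(w) ≤ κhi` and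
`|κ'(w)| ≤ k₁` along the solution, for a `C¹` speed `κ > 0` with `C²` primitive `K` and with `κ' ≥ 0` continuous and not identically
zero on any nontrivial interval, is CONSTANT.  Proof: the p-system partner of `exists_pSystem_partner` + the tree theorem
`…ZShockPSystemNonuniformConst.pSystem_const_nonuniform`. [folklore] (Lax 1964 / John 1974 two-sided) -/
theorem scalarWave_const_nonuniform (hw : ContDiff ℝ 2 w)
    (hK2 : ContDiff ℝ 2 K) (hKd : ∀ v, HasDerivAt K (κ v) v) (hκd : ∀ v, HasDerivAt κ (κ' v) v) (hκ'c : Continuous κ')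
    (hpde : ∀ q : ℝ × ℝ, fderiv ℝ (fun q' => fderiv ℝ w q' (1, 0)) q (1, 0) =
      fderiv ℝ (fun q' => κ (w q') ^ 2 * fderiv ℝ w q' (0, 1)) q (0, 1))
    (hκlo0 : 0 < κlo) (hκlo : ∀ q, κlo ≤ κ (w q)) (hκhi : ∀ q, κ (w q) ≤ κhi)
    (hκpos : ∀ v, 0 < κ v) (hgnl : ∀ v, 0 ≤ κ' v) (hgn : ∀ a b : ℝ, a < b → ∃ v ∈ Ioo a b, κ' v ≠ 0)
    (hk₁ : ∀ q, |κ' (w q)| ≤ k₁) (hW₁ : ∀ q, |fderiv ℝ w q (0, 1)| ≤ W₁) (hW₂ : ∀ q, |fderiv ℝ w q (1, 0)| ≤ W₂)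
    (hMw : ∀ q, |w q| ≤ Mw) :
    ∀ q q' : ℝ × ℝ, w q = w q' := by
  obtain ⟨p, hp, hsys1, hsys2⟩ := exists_pSystem_partner hw (contDiff_one_of_hasDerivAt hκd hκ'c) hpde
  intro q q'
  exact (pSystem_const_nonuniform hw hp hK2 hKd hκd hκ'c hsys1 hsys2 hκlo0 hκlo hκhi hκpos hgnl hgn hk₁ hW₁ hW₂ hMw q q').1

/-- ★ **R2, scalar form, `κ' ≤ 0`.**  The same conclusion when the genuine-nonlinearity coefficient has the other sign: `κ' ≤ 0`
continuous and not identically zero on any nontrivial interval.  Proof: the reflected solution `w̃ = −w` solves the same equation with the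
speed `κ̃ = κ(−·)`, whose derivative `κ̃' = −κ'(−·) ≥ 0`, and `scalarWave_const_nonuniform` applies to it. [folklore] -/
theorem scalarWave_const_nonuniform_antitone (hw : ContDiff ℝ 2 w)
    (hK2 : ContDiff ℝ 2 K) (hKd : ∀ v, HasDerivAt K (κ v) v) (hκd : ∀ v, HasDerivAt κ (κ' v) v) (hκ'c : Continuous κ')
    (hpde : ∀ q : ℝ × ℝ, fderiv ℝ (fun q' => fderiv ℝ w q' (1, 0)) q (1, 0) =
      fderiv ℝ (fun q' => κ (w q') ^ 2 * fderiv ℝ w q' (0, 1)) q (0, 1))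
    (hκlo0 : 0 < κlo) (hκlo : ∀ q, κlo ≤ κ (w q)) (hκhi : ∀ q, κ (w q) ≤ κhi)
    (hκpos : ∀ v, 0 < κ v) (hgnl : ∀ v, κ' v ≤ 0) (hgn : ∀ a b : ℝ, a < b → ∃ v ∈ Ioo a b, κ' v ≠ 0)
    (hk₁ : ∀ q, |κ' (w q)| ≤ k₁) (hW₁ : ∀ q, |fderiv ℝ w q (0, 1)| ≤ W₁) (hW₂ : ∀ q, |fderiv ℝ w q (1, 0)| ≤ W₂)
    (hMw : ∀ q, |w q| ≤ Mw) :
    ∀ q q' : ℝ × ℝ, w q = w q' := by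
  -- the reflected data
  have hw1 : Differentiable ℝ w := hw.differentiable two_ne_zero
  have hnw : ContDiff ℝ 2 fun q => -w q := hw.neg
  have hDneg : ∀ q, fderiv ℝ (fun q' => -w q') q = -fderiv ℝ w q := fun q => fderiv_fun_neg
  have hnK2 : ContDiff ℝ 2 fun v => -K (-v) := (hK2.comp contDiff_neg).neg
  have hnKd : ∀ v, HasDerivAt (fun v => -K (-v)) (κ (-v)) v := by
    intro v
    have h1 : HasDerivAt (fun v => K (-v)) (κ (-v) * (-1)) v := (hKd (-v)).comp v (hasDerivAt_neg v)
    have h2 : HasDerivAt (fun v => -K (-v)) (-(κ (-v) * (-1))) v := h1.neg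
    convert h2 using 1
    ring
  have hnκd : ∀ v, HasDerivAt (fun v => κ (-v)) (-κ' (-v)) v := by
    intro v
    have h1 : HasDerivAt (fun v => κ (-v)) (κ' (-v) * (-1)) v := (hκd (-v)).comp v (hasDerivAt_neg v)
    convert h1 using 1
    ring
  have hnκ'c : Continuous fun v => -κ' (-v) := (hκ'c.comp continuous_neg).neg
  -- the reflected equation
  have hnpde : ∀ q : ℝ × ℝ, fderiv ℝ (fun q' => fderiv ℝ (fun q'' => -w q'') q' (1, 0)) q (1, 0) =
      fderiv ℝ (fun q' => κ (-(-w q')) ^ 2 * fderiv ℝ (fun q'' => -w q'') q' (0, 1)) q (0, 1) := by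
    intro q
    have h1 : (fun q' => fderiv ℝ (fun q'' => -w q'') q' (1, 0)) = fun q' => -fderiv ℝ w q' (1, 0) := by
      funext q'; rw [hDneg q', neg_apply]
    have h2 : (fun q' => κ (-(-w q')) ^ 2 * fderiv ℝ (fun q'' => -w q'') q' (0, 1)) =
        fun q' => -(κ (w q') ^ 2 * fderiv ℝ w q' (0, 1)) := by
      funext q'; rw [hDneg q', neg_apply, neg_neg, mul_neg]
    rw [h1, h2, fderiv_fun_neg, fderiv_fun_neg, neg_apply, neg_apply, hpde q]
  have hgn' : ∀ a b : ℝ, a < b → ∃ v ∈ Ioo a b, -κ' (-v) ≠ 0 := by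
    intro a b hab
    obtain ⟨v, hv, hv0⟩ := hgn (-b) (-a) (by linarith)
    exact ⟨-v, ⟨by linarith [hv.2], by linarith [hv.1]⟩, by simpa using hv0⟩
  have key := scalarWave_const_nonuniform (w := fun q => -w q) (κ := fun v => κ (-v)) (κ' := fun v => -κ' (-v))
    (K := fun v => -K (-v)) (κlo := κlo) (κhi := κhi) (k₁ := k₁) (W₁ := W₁) (W₂ := W₂) (Mw := Mw)
    hnw hnK2 hnKd hnκd hnκ'c hnpde hκlo0
    (fun q => by simpa using hκlo q) (fun q => by simpa using hκhi q) (fun v => hκpos (-v))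
    (fun v => by simpa using hgnl (-v)) hgn'
    (fun q => by simpa using hk₁ q)
    (fun q => by rw [hDneg q, neg_apply, abs_neg]; exact hW₁ q)
    (fun q => by rw [hDneg q, neg_apply, abs_neg]; exact hW₂ q)
    (fun q => by simpa using hMw q)
  intro q q'
  have h := key q q'
  simpa using h

end Summit.NavierStokesRegularity.NavierStokesRegularity.Theorems.PoloidalWindowDoorPoloidalWindowRigidityZShockScalarWaveLiouville
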